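import Summits.QuantumFields.BalabanUV.T4Continuum.Support.NE7NestedCovariantExtension
import Summits.QuantumFields.BalabanUV.T4Continuum.Support.NE7EnergyBlockLandauPoincare
import Summits.QuantumFields.BalabanUV.T4Continuum.Support.NE3CurvedCornerGaugeSpace
import Summits.QuantumFields.BalabanUV.T4Continuum.Support.NE3BlockLineAverage
import HarnessLib

/-!
# NE7EnergySliceLocalForm — THE NESTED EXTENSION IS THE ADJOINT OF THE NESTED TRANSPORTED MEAN, hence THE LOCAL FORM OF THE ENERGY SLICE `𝒯_E(W)` (memo ROAD-G100 §4 (1),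
# the input every localisation of the curved sup letter needs): `Y ∈ energyBlockLandauW L N (k+1) W` ⟹ the covariant divergence `covDiv W Y` is the NESTED COVARIANT BLOCK-CONSTANT
# EXTENSION OF ITS OWN NESTED MEAN, `covDiv W Y = nestedExt L (k+1) W (bmeanIterW L (k+1) W (covDiv W Y))` — a condition checked block by block; and conversely every skew
# periodic `Y ∈ ker Q̄` with `covDiv W Y = nestedExt c` is in `𝒯_E(W)`

Cell `pub-balaban`, rung (B)+1 sub-cell t4, lineage `b2b-balaban-t4-ne7-p1`, generation 100 (CRUX PROVER NE7 #1 = OWNER of BINDER row NE7).  Memo `t4/b2b-balaban-t4-ne7-p1-g100/ROAD-G100.md` §4: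
the curved sup letter of `𝒯_E` is to be proved by a bootstrap that lifts a slice element to a cover, cuts it off and transplants it onto a fresh flat torus; the slice condition of
`NE7MeanZeroGaugeSliceW.energyBlockLandauW` is stated as a GLOBAL orthogonality (`Σ hsR Y (gaugeDir W ζ) = 0` for every `ζ ∈ Ξ_Q(W)` over the whole period box) and does not transplant;
THIS FILE gives its LOCAL form.  The mechanism is one identity: **the nested covariant extension `nestedExt` of `NE7NestedCovariantExtension` (gen 100) is `M^d` times the `hsR`-ADJOINT of the
nested transported mean `bmeanIterW`** (one level: `Σ_z hsR (bmeanW L W μ z) (c z) = L^{−d}·Σ_x hsR (μ x) (covExt L W c x)` — move `Ad` across `hsR` and tile the period box by blocks;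
then induction through the tower), so that `nestedExt ∘ bmeanIterW` is the `hsR`-orthogonal projection onto `(Ξ_Q)^⊥` (`bmeanIterW ∘ nestedExt = id`, gen 100), and `Y ⊥ gaugeDir W(Ξ_Q)`
⟺ `covDiv W Y ⊥ Ξ_Q` (`NE3LandauOrbit.sum_hsR_gaugeDir`) ⟺ `covDiv W Y` is fixed by that projection.
WHAT ([folklore]; 0 def, 0 sorry).
§1 **`sum_hsR_bmeanW`** (one level, every `W` unitary): `Σ_{z ∈ periodBox P} hsR (bmeanW L W μ z) (c z) = (L^d)⁻¹ · Σ_{x ∈ periodBox (L·P)} hsR (μ x) (covExt L W c x)`.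
§2 **`sum_hsR_bmeanIterW`** (through the tower, multi-level small-field class): `Σ_{z ∈ periodBox N} hsR (bmeanIterW L (j+1) W μ z) (c z)
   = ((L^{j+1})^d)⁻¹ · Σ_{x ∈ periodBox (tower L N (j+1))} hsR (μ x) (nestedExt L (j+1) W c x)`; `sum_hsR_nestedExt_eq_zero_of_bmeanIterW_eq_zero` (`nestedExt c ⊥ Ξ_Q(W)`).
§3 **`covDiv_eq_nestedExt_of_mem`** (THE LOCAL FORM): `Y ∈ energyBlockLandauW L N (j+1) W` (class; `W` periodic) ⟹
   `∀ x, covDiv W Y x = nestedExt L (j+1) W (bmeanIterW L (j+1) W (covDiv W Y)) x`.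
§4 **`orthogonal_of_covDiv_eq_nestedExt`** (CONVERSE): `Y` periodic, `covDiv W Y = nestedExt L (j+1) W c` (any coarse `c`) ⟹ `Σ hsR Y (gaugeDir W ζ) = 0` for every `ζ ∈ Ξ_Q(W)`.
§5 **`mem_energyBlockLandauW_cover`** (THE COVER TRANSFER, appended gen 100): `Y ∈ energyBlockLandauW L N (j+1) W` ⟹ `Y ∈ energyBlockLandauW L (m·N) (j+1) W` for every `m ≥ 1` —
   every slice condition is local, so a slice element is a slice element of every cover of the torus (memo §4 (1): WLOG the torus is large).
HONEST FRAMING (page 1): exact linear kinematics∕summation by parts at ONE background; nothing of Bałaban's asserted; NOT the curved letter, NOT (S1), NOT NE7; spine 0∕9; finite T⁴ rung (B)+1 —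
NOT infinite volume, NOT mass gap, NOT BetaPertH, NOT Clay.  Continuum YM on T⁴ ⇐ BetaPertH ∧ nine spine estimates (0/9 proved); BetaPertH ⇐ (D1) ∧ (D4) ∧ CAP+tail; G-an2-4 gates asym, D1
and NE2/3/4.  Text locations only: [Balaban1984PropagatorsI] (1.25)–(1.26) p. 22 (Bałaban's `R∂^*A = 0` is a DIFFERENT, global gauge; this is the local one of memo ROAD-G99 §3.6).
-/

set_option autoImplicit false

open scoped BigOperators Matrix.Norms.L2Operator
open Finset

namespace Summit.QuantumFields.BalabanUV.T4Continuum.NE7EnergySliceLocalForm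

open Literature.MathematicalPhysics.QuantumFieldTheory.Balaban1983to89
open B7Prop1Explicit B7Prop2Explicit
open T4AveragingDeficitWall (IsUnitaryCfg IsSkewDir SmallField Ad)
open T4AveragingDeficitWallBoundary (IsPeriodicCfg periodBox)
open AveragingDeficitPeriodicCounting (IsPeriodicDir)
open AveragingDeficitChartCalculus (cavg)
open AveragingDeficitFermat (isPeriodicCfg_cavg)
open AveragingDeficitMultiLevelPrep (cavgIter LevelSmall tower natCast_tower_succ)
open BlockAveragePushDirGauge (gaugeDir)
open NE3TangentCovariantTower (step_small)
open NE3CovariantCalculus (hsR hsR_Ad_left hsR_sum_left hsR_sub_left hsR_comm hsR_self)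
open NE3FrameFreeDecompositionPrep (hsR_smul_left)
open NE3CovariantBlockMean (bmeanW bmeanIterW bmeanIterW_succ bmeanIterW_zero boxVec_bounds bmeanIterW_skew_periodic)
open NE3CovariantWeitzenbock (covDiv)
open NE3LandauOrbit (sum_hsR_gaugeDir covDiv_add_period eq_zero_of_nhsNormSq_eq_zero)
open MatrixNorms (nhsNormSq nhsNormSq_nonneg)
open NE3CurvedCornerGaugeSpace (covDiv_mem_skewAdjoint)
open NE3BlockLineAverage (sum_univ_boxVec sum_periodBox_blocks)
open NE3GaugeDirFrames (Ad_Ad_inv)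
open NE7EnergyBlockLandauPoincare (bmeanIterW_sub)
open NE7MeanZeroGaugeSliceW (energyBlockLandauW meanZeroGaugeSpaceW mem_meanZeroGaugeSpaceW_iff)
open NE7NestedCovariantExtension (covExt nestedExt nestedExt_succ nestedExt_zero bmeanIterW_nestedExt nestedExt_skew nestedExt_add_period)
open SmoothRefineBlocks (blk res blk_res_eq_of)
open PeriodicChoice (apply_wrap_eq wrap_mem_periodBox periodic_zmul)

noncomputable section

variable {d : ℕ} {n : Type*} [Fintype n] [DecidableEq n]

/-! ## §1 One level: `covExt` is `L^d` times the adjoint of `bmeanW` -/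

/-- **ONE-LEVEL ADJOINTNESS**: for unitary `W`, any site fields `μ`, `c` and any `P`,
`Σ_{z ∈ periodBox P} hsR (bmeanW L W μ z) (c z) = (L^d)⁻¹ · Σ_{x ∈ periodBox (L·P)} hsR (μ x) (covExt L W c x)` (move the unitary transport across `hsR`; tile the fine box by blocks).
[folklore] -/
theorem sum_hsR_bmeanW {L : ℕ} (hL : 1 ≤ L) {W : Site d → Fin d → (Matrix n n ℂ)ˣ} (hWu : IsUnitaryCfg W) (μ c : Site d → Matrix n n ℂ) (P : ℕ) :
    ∑ z ∈ periodBox (d := d) P, hsR (bmeanW L W μ z) (c z)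
      = ((L : ℝ) ^ d)⁻¹ * ∑ x ∈ periodBox (d := d) (L * P), hsR (μ x) (covExt L W c x) := by
  -- pointwise on a block: the transported average against `c z` is the average of `μ` against the back-transported `c z`
  have hblock : ∀ z : Site d, hsR (bmeanW L W μ z) (c z)
      = ((L : ℝ) ^ d)⁻¹ * ∑ v ∈ periodBox (d := d) L, hsR (μ ((L : ℤ) • z + v)) (covExt L W c ((L : ℤ) • z + v)) := by
    intro z
    unfold bmeanW
    rw [hsR_sum_left, Finset.mul_sum, ← sum_univ_boxVec]
    refine Finset.sum_congr rfl fun r _ => ?_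
    rw [hsR_smul_left, hsR_Ad_left (hol_mem_of hWu _ _)]
    congr 2
    obtain ⟨hb, hr⟩ := blk_res_eq_of hL (y := (L : ℤ) • z + boxVec L r) rfl (fun i => (boxVec_bounds L r i).1) (fun i => (boxVec_bounds L r i).2)
    unfold covExt
    rw [hb, hr]
  simp_rw [hblock]
  rw [← Finset.mul_sum]
  congr 1
  exact sum_periodBox_blocks L P hL (fun w => hsR (μ w) (covExt L W c w))

/-! ## §2 Through the tower: `nestedExt` is `M^d` times the adjoint of `bmeanIterW` -/

/-- **NESTED ADJOINTNESS** (multi-level small-field class: `W` unitary, `0 ≤ x`, `LevelSmall d L j x`, `SmallField W x`, so that every averaged background is unitary):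
`Σ_{z ∈ periodBox N} hsR (bmeanIterW L (j+1) W μ z) (c z) = ((L^{j+1})^d)⁻¹ · Σ_{x ∈ periodBox (tower L N (j+1))} hsR (μ x) (nestedExt L (j+1) W c x)`. [folklore] -/
theorem sum_hsR_bmeanIterW [Nonempty n] {L : ℕ} (hL : 1 ≤ L) (N : ℕ) :
    ∀ (j : ℕ) {W : Site d → Fin d → (Matrix n n ℂ)ˣ} {x : ℝ}, IsUnitaryCfg W → 0 ≤ x → LevelSmall d L j x → SmallField W x →
    ∀ (μ c : Site d → Matrix n n ℂ),
      ∑ z ∈ periodBox (d := d) N, hsR (bmeanIterW L (j + 1) W μ z) (c z)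
        = (((L : ℝ) ^ (j + 1)) ^ d)⁻¹ * ∑ y ∈ periodBox (d := d) (tower L N (j + 1)), hsR (μ y) (nestedExt L (j + 1) W c y) := by
  intro j
  induction j with
  | zero =>
      intro W x hWu _ _ _ μ c
      rw [bmeanIterW_succ, bmeanIterW_zero, nestedExt_succ, zero_add, pow_one]
      have h := sum_hsR_bmeanW hL hWu μ (nestedExt L 0 (cavg L W) c) N
      simp only [nestedExt_zero] at h ⊢
      rw [h]
      rfl
  | succ j ih =>
      intro W x hWu hx hs hWx μ c
      obtain ⟨-, hW₁u, hr0, hW₁x⟩ := step_small hL hWu hx hs.1 hWx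
      have hcoef : (((L : ℝ) ^ (j + 1)) ^ d)⁻¹ * (((L : ℝ) ^ d)⁻¹) = (((L : ℝ) ^ (j + 1 + 1)) ^ d)⁻¹ := by
        rw [← mul_inv, pow_succ (L : ℝ) (j + 1), mul_pow]
      rw [bmeanIterW_succ, nestedExt_succ, ih hW₁u hr0 hs.2 hW₁x (bmeanW L W μ) c,
        sum_hsR_bmeanW hL hWu μ (nestedExt L (j + 1) (cavg L W) c) (tower L N (j + 1)), ← mul_assoc, hcoef]
      rfl

/-- **`nestedExt c` IS `hsR`-ORTHOGONAL TO `Ξ_Q(W)`**: `bmeanIterW L (j+1) W ζ = 0` ⟹ `Σ_{x ∈ periodBox (tower)} hsR (ζ x) (nestedExt L (j+1) W c x) = 0`. [folklore] -/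
theorem sum_hsR_nestedExt_eq_zero_of_bmeanIterW_eq_zero [Nonempty n] {L : ℕ} (hL : 1 ≤ L) (N j : ℕ) {W : Site d → Fin d → (Matrix n n ℂ)ˣ} {x : ℝ}
    (hWu : IsUnitaryCfg W) (hx : 0 ≤ x) (hs : LevelSmall d L j x) (hWx : SmallField W x)
    {ζ : Site d → Matrix n n ℂ} (hζ : bmeanIterW L (j + 1) W ζ = 0) (c : Site d → Matrix n n ℂ) :
    ∑ y ∈ periodBox (d := d) (tower L N (j + 1)), hsR (ζ y) (nestedExt L (j + 1) W c y) = 0 := by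
  have hL0 : (0 : ℝ) < ((L : ℝ) ^ (j + 1)) ^ d := by
    have : (0 : ℝ) < L := by exact_mod_cast (by omega : 0 < L)
    positivity
  have h := sum_hsR_bmeanIterW hL N j hWu hx hs hWx ζ c
  rw [hζ] at h
  simp only [Pi.zero_apply, NE3LandauOrbit.hsR_zero_left, Finset.sum_const_zero] at h
  have h' := h.symm
  rwa [mul_eq_zero, or_iff_right (inv_ne_zero hL0.ne')] at h'

/-! ## §3 THE LOCAL FORM of the energy slice -/

/-- **THE LOCAL FORM OF `𝒯_E(W)`** (multi-level small-field class at level `j+1`, `W` unitary of period `tower L N (j+1)`): for `Y ∈ energyBlockLandauW L N (j+1) W`,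
`covDiv W Y = nestedExt L (j+1) W (bmeanIterW L (j+1) W (covDiv W Y))` at EVERY site — the covariant divergence of a slice element is the nested covariant block-constant extension of
its own nested block mean (on each top block: ONE matrix, transported).  [`R := covDiv W Y − nestedExt(bmeanIterW(covDiv W Y))` has nested mean `0` (exactness of `nestedExt`), is skew and
periodic, hence `∈ Ξ_Q(W)`; the slice orthogonality read through `sum_hsR_gaugeDir` says `covDiv W Y ⊥ R`, §2 says `nestedExt(…) ⊥ R`; so `Σ nhsNormSq R = 0`.] [folklore] -/
theorem covDiv_eq_nestedExt_of_mem [Nonempty n] {L N : ℕ} [NeZero N] (hL : 1 ≤ L) (j : ℕ)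
    {W : Site d → Fin d → (Matrix n n ℂ)ˣ} {x : ℝ} (hWu : IsUnitaryCfg W) (hWP : IsPeriodicCfg W ((tower L N (j + 1) : ℕ) : ℤ))
    (hx : 0 ≤ x) (hs : LevelSmall d L j x) (hWx : SmallField W x)
    {Y : Site d → Fin d → Matrix n n ℂ} (hY : Y ∈ energyBlockLandauW (d := d) (n := n) L N (j + 1) W) (y : Site d) :
    covDiv W Y y = nestedExt L (j + 1) W (bmeanIterW L (j + 1) W (covDiv W Y)) y := by
  haveI : NeZero L := ⟨by omega⟩
  obtain ⟨hYs, hYP, -, horth⟩ := hY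
  have hP1 : 1 ≤ tower L N (j + 1) := Nat.one_le_iff_ne_zero.mpr (NeZero.ne _)
  set D : Site d → Matrix n n ℂ := covDiv W Y with hD
  set c : Site d → Matrix n n ℂ := bmeanIterW L (j + 1) W D with hc
  set R : Site d → Matrix n n ℂ := fun z => D z - nestedExt L (j + 1) W c z with hR
  -- `D` is skew and periodic; so is `c` (coarse, `N`-periodic) and `nestedExt c`; hence `R`
  have hDs : ∀ z, D z ∈ skewAdjoint (Matrix n n ℂ) := fun z => covDiv_mem_skewAdjoint hWu hYs z
  have hDP : ∀ (z : Site d) (i : Fin d), D (z + ((tower L N (j + 1) : ℕ) : ℤ) • e i) = D z := fun z i => covDiv_add_period hWP hYP z i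
  obtain ⟨hcs, hcP⟩ := bmeanIterW_skew_periodic (M := N) hL j hWu hWP hx hs hWx hDs hDP
  have hEs : ∀ z, nestedExt L (j + 1) W c z ∈ skewAdjoint (Matrix n n ℂ) := nestedExt_skew hL j hWu hx hs hWx hcs
  have hEP : ∀ (z : Site d) (i : Fin d), nestedExt L (j + 1) W c (z + ((tower L N (j + 1) : ℕ) : ℤ) • e i) = nestedExt L (j + 1) W c z :=
    nestedExt_add_period hL (j + 1) hWP hcP
  have hRs : ∀ z, R z ∈ skewAdjoint (Matrix n n ℂ) := fun z => (skewAdjoint _).sub_mem (hDs z) (hEs z)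
  have hRP : ∀ (z : Site d) (i : Fin d), R z = R (z + ((tower L N (j + 1) : ℕ) : ℤ) • e i) := fun z i => by simp only [hR, hDP z i, hEP z i]
  -- `R` has nested mean zero, so `R ∈ Ξ_Q(W)`
  have hRm : bmeanIterW L (j + 1) W R = 0 := by
    have h := bmeanIterW_sub L (j + 1) W D (nestedExt L (j + 1) W c)
    rw [bmeanIterW_nestedExt hL] at h
    rw [hR, h]; funext z; simp [hc]
  have hRmem : R ∈ meanZeroGaugeSpaceW (d := d) (n := n) L (j + 1) W (tower L N (j + 1)) :=
    mem_meanZeroGaugeSpaceW_iff.mpr ⟨⟨fun z i => (hRP z i).symm, hRs⟩, hRm⟩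
  -- the slice orthogonality against `R`, in divergence form: `Σ hsR (D x) (R x) = 0`
  have h1 : ∑ z ∈ periodBox (d := d) (tower L N (j + 1)), hsR (D z) (R z) = 0 := by
    rw [← sum_hsR_gaugeDir hP1 hWu hYP (fun z i => (hRP z i).symm)]
    exact horth R hRmem
  -- `nestedExt c ⊥ R`
  have h2 : ∑ z ∈ periodBox (d := d) (tower L N (j + 1)), hsR (nestedExt L (j + 1) W c z) (R z) = 0 := by
    have h := sum_hsR_nestedExt_eq_zero_of_bmeanIterW_eq_zero hL N j hWu hx hs hWx hRm c
    rw [← h]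
    exact Finset.sum_congr rfl fun z _ => hsR_comm _ _
  -- hence `Σ nhsNormSq R = 0` and `R = 0` on the period box, hence everywhere
  have h3 : ∑ z ∈ periodBox (d := d) (tower L N (j + 1)), hsR (R z) (R z) = 0 := by
    have e : ∀ z, hsR (R z) (R z) = hsR (D z) (R z) - hsR (nestedExt L (j + 1) W c z) (R z) := fun z => by
      rw [hR]; exact hsR_sub_left _ _ _
    simp_rw [e, Finset.sum_sub_distrib, h1, h2, sub_zero]
  simp_rw [hsR_self] at h3
  have hzero := (Finset.sum_eq_zero_iff_of_nonneg fun z _ => nhsNormSq_nonneg (R z)).1 h3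
  have hRy : R y = 0 := by
    have hw := apply_wrap_eq (g := R) (fun z i => (hRP z i).symm) y
    rw [← hw]
    exact eq_zero_of_nhsNormSq_eq_zero (hzero _ (wrap_mem_periodBox _ hP1 y))
  have : D y - nestedExt L (j + 1) W c y = 0 := hRy
  exact sub_eq_zero.mp this

/-! ## §4 The converse -/

/-- **CONVERSE**: for unitary `W` in the class, a `(tower)`-periodic `Y` whose covariant divergence is a nested extension, `covDiv W Y = nestedExt L (j+1) W c` (any `c`), is
`hsR`-orthogonal to `gaugeDir W ζ` for every `ζ ∈ Ξ_Q(W)`. [folklore] -/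
theorem orthogonal_of_covDiv_eq_nestedExt [Nonempty n] {L N : ℕ} [NeZero N] (hL : 1 ≤ L) (j : ℕ)
    {W : Site d → Fin d → (Matrix n n ℂ)ˣ} {x : ℝ} (hWu : IsUnitaryCfg W) (hx : 0 ≤ x) (hs : LevelSmall d L j x) (hWx : SmallField W x)
    {Y : Site d → Fin d → Matrix n n ℂ} (hYP : IsPeriodicDir Y ((tower L N (j + 1) : ℕ) : ℤ)) {c : Site d → Matrix n n ℂ}
    (hc : ∀ y, covDiv W Y y = nestedExt L (j + 1) W c y)
    {ζ : Site d → Matrix n n ℂ} (hζ : ζ ∈ meanZeroGaugeSpaceW (d := d) (n := n) L (j + 1) W (tower L N (j + 1))) :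
    ∑ y ∈ periodBox (d := d) (tower L N (j + 1)), ∑ κ : Fin d, hsR (Y y κ) (gaugeDir W ζ y κ) = 0 := by
  haveI : NeZero L := ⟨by omega⟩
  have hP1 : 1 ≤ tower L N (j + 1) := Nat.one_le_iff_ne_zero.mpr (NeZero.ne _)
  obtain ⟨⟨hζP, -⟩, hζm⟩ := mem_meanZeroGaugeSpaceW_iff.mp hζ
  rw [sum_hsR_gaugeDir hP1 hWu hYP hζP]
  simp_rw [hc]
  have h := sum_hsR_nestedExt_eq_zero_of_bmeanIterW_eq_zero hL N j hWu hx hs hWx hζm c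
  rw [← h]
  exact Finset.sum_congr rfl fun z _ => hsR_comm _ _

/-! ## §5 The cover transfer -/

/-- `tower L (m·N) i = m · tower L N i`. [folklore] -/
theorem tower_mul_left (L m N : ℕ) : ∀ i : ℕ, tower L (m * N) i = m * tower L N i
  | 0 => rfl
  | i + 1 => by
      show L * tower L (m * N) i = m * (L * tower L N i)
      rw [tower_mul_left L m N i]; ring

/-- **THE COVER TRANSFER** (multi-level small-field class at level `j+1`, `W` unitary of period `tower L N (j+1)`): a slice element is a slice element of every cover,
`Y ∈ energyBlockLandauW L N (j+1) W` ⟹ `Y ∈ energyBlockLandauW L (m·N) (j+1) W` (`m ≥ 1`) — skewness, `Q̄ = 0` and the LOCAL form §3 of the orthogonality do not see the period,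
and §4 turns the local form back into the orthogonality against the larger `Ξ_Q`. [folklore] -/
theorem mem_energyBlockLandauW_cover [Nonempty n] {L N : ℕ} [NeZero N] (hL : 1 ≤ L) (j : ℕ)
    {W : Site d → Fin d → (Matrix n n ℂ)ˣ} {x : ℝ} (hWu : IsUnitaryCfg W) (hWP : IsPeriodicCfg W ((tower L N (j + 1) : ℕ) : ℤ))
    (hx : 0 ≤ x) (hs : LevelSmall d L j x) (hWx : SmallField W x)
    {Y : Site d → Fin d → Matrix n n ℂ} (hY : Y ∈ energyBlockLandauW (d := d) (n := n) L N (j + 1) W) {m : ℕ} (hm : 1 ≤ m) :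
    Y ∈ energyBlockLandauW (d := d) (n := n) L (m * N) (j + 1) W := by
  haveI : NeZero (m * N) := ⟨Nat.mul_ne_zero (by omega) (NeZero.ne N)⟩
  obtain ⟨hYs, hYP, hYQ, -⟩ := id hY
  have hYP' : IsPeriodicDir Y ((tower L (m * N) (j + 1) : ℕ) : ℤ) := by
    intro y κ μ
    rw [tower_mul_left, Nat.cast_mul]
    exact congr_fun (periodic_zmul (g := Y) (fun y' κ' => funext fun μ' => hYP y' κ' μ') y κ (m : ℤ)) μ
  refine ⟨hYs, hYP', hYQ, fun ζ hζ => ?_⟩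
  exact orthogonal_of_covDiv_eq_nestedExt hL j hWu hx hs hWx hYP' (c := bmeanIterW L (j + 1) W (covDiv W Y))
    (fun y => covDiv_eq_nestedExt_of_mem hL j hWu hWP hx hs hWx hY y) hζ

end

end Summit.QuantumFields.BalabanUV.T4Continuum.NE7EnergySliceLocalForm
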